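import Summits.CriticalPhenomena.PercolationContinuityZ3.Theorems.PercNearOneGluingAdditiveGluingPeelAssembly
import Summits.CriticalPhenomena.PercolationContinuityZ3.Theorems.PercNearOneGluingAdditiveGluingBlockGoodTwoRelays
import HarnessLib

/-! # Crux `PercNearOneGluing.AdditiveGluing` (stmt-CriticalPhenomena-4576): **the crux follows from the CONE growth step** (part 1/2: block goodness)

Lead c5 (line `peel`, skeleton v3 `Cruxes/AdditiveGluing/Lines/peel.lean`); lands `--supports stmt-CriticalPhenomena-4576`.
No definitions, no named facts.  CONDITIONAL result: the main theorems take the cone step `hcone` (spelled out in each statement).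

`conePeel` (the registered stub `stub_conePeel` of skeleton v3): for a weighting `u`, relays `A ∋ b` with `4 ≤ A.card`, a minimiser
`a₀` of `μ_u(· ↔ b)` over `A`, a non-empty block `T` of non-relays, a vertex `x ∉ A ∪ T` with all of `T ∪ {x}` bad, and the
induction hypothesis of the skeleton (goodness of every quadruple on a weighting with at most as many positive-degree vertices as
`u`): if `T` is `a₀`-good in block form with the worst selection,
`τ(a₀) + μ(a₀↮b, a₀↔T, T↔b) ≤ μ(T↔b) + Σ_{W ∩ A = ∅} μ(K_T = W)·min_A μ(a ↔ b off W)`, then so is `T ∪ {x}`.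
This is the CONE consequence of the ratio step (`pairGamma ∧ goodStaysGood`, `coneLine_of_pairGamma` below), strictly weaker, and it is
exactly what the peel chain consumes: `coneLine_blockGood` (induction on `|T|` from the point `s`, whose goodness the induction
hypothesis supplies; at most two relays besides `b` directly by the landed drift theorem `blockGood_cardLeThree`),
`coneLine_goodStep` (`goodStep24_main` + un-gluing), `coneLine_good_all`, `coneLine_additiveGluing_of` (KN level sets), and the
registered handle `stub_additiveGluingOfConePeel_c5 : conePeel → AdditiveGluing`.  Numerics of the cone step (lead c5, exact partition
DP, n ≤ 7, designation `argmin τ_u`): 0 violations in 6 152 / 3 840 / 508 instances at `|T| = 1 / 2 / 3`; FALSE at an arbitrary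
designation (exact 7-vertex witness with both points good and the pair not), so the minimiser hypothesis is load-bearing.
[cite: KozmaNitzan2024, §3.2 Definition p. 12, Thms 4–5 pp. 12–14, Lemma 5 p. 13, §5.3 p. 34, Question 7 & 9 p. 36]
-/

namespace Summit.CriticalPhenomena.PercolationContinuityZ3.Theorems

open MeasureTheory Set
open Literature.Probability.LatticeModels (prodBernoulli)
open Literature.Probability.Percolation (BondConfig openConn openConnIn openGraph openCluster)
open scoped BigOperators Classical

noncomputable section

/-! ## Real proofs -/

variable {n : ℕ}

/-- The block event of a singleton is the fibre of the point cluster: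
`{ω | ∀ z, z ∈ W ↔ ω ∈ ⋃ v ∈ {s}, v↔z} = {ω | C(s) = W}`. [folklore] -/
theorem coneLine_blockEvent_singleton (s : Fin n) (W : Finset (Fin n)) :
    {ω : BondConfig (Fin n) | ∀ z : Fin n, (z ∈ W ↔ ω ∈ ⋃ v ∈ ({s} : Finset (Fin n)), openConn v z)}
      = {ω : BondConfig (Fin n) | openCluster ω s = (W : Set (Fin n))} := by
  ext ω
  simp only [Finset.set_biUnion_singleton, Set.mem_setOf_eq]
  constructor
  · intro h
    ext z
    rw [Finset.mem_coe]
    exact ⟨fun hz => (h z).2 hz, fun hz => (h z).1 hz⟩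
  · intro h z
    rw [← Finset.mem_coe, ← h]
    exact Iff.rfl

/-- **Block goodness of the singleton `{s}` from point goodness of `s`** (worst selection; the gain term of a singleton block
vanishes and its pocket sum contains the point's). [cite: KozmaNitzan2024, §3.2 Definition p. 12] -/
theorem coneLine_blockGood_singleton (u : Sym2 (Fin n) → unitInterval) (A : Finset (Fin n)) (b a₀ s : Fin n)
    (hb : b ∈ A)
    (hpt : (prodBernoulli u).real (openConn a₀ b) ≤ (prodBernoulli u).real (openConn s b)
      + (∑ W ∈ (Finset.univ : Finset (Finset (Fin n))).filter (fun W => s ∈ W ∧ Disjoint W A),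
          (prodBernoulli u).real {ω : BondConfig (Fin n) | openCluster ω s = (W : Set (Fin n))}
            * A.inf' ⟨b, hb⟩ (fun a => (prodBernoulli u).real (openConnIn ((W : Set (Fin n))ᶜ) a b)))) :
    (prodBernoulli u).real (openConn a₀ b)
        + (prodBernoulli u).real
            ((openConn a₀ b)ᶜ ∩ (⋃ v ∈ ({s} : Finset (Fin n)), openConn a₀ v) ∩ (⋃ v ∈ ({s} : Finset (Fin n)), openConn v b))
      ≤ (prodBernoulli u).real (⋃ v ∈ ({s} : Finset (Fin n)), openConn v b)
        + (∑ W ∈ (Finset.univ : Finset (Finset (Fin n))).filter (fun W => Disjoint W A),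
            (prodBernoulli u).real
                {ω : BondConfig (Fin n) | ∀ z : Fin n, (z ∈ W ↔ ω ∈ ⋃ v ∈ ({s} : Finset (Fin n)), openConn v z)}
              * A.inf' ⟨b, hb⟩ (fun a => (prodBernoulli u).real (openConnIn ((W : Set (Fin n))ᶜ) a b))) := by
  -- the gain term vanishes
  have hgain : (prodBernoulli u).real
      ((openConn a₀ b)ᶜ ∩ (⋃ v ∈ ({s} : Finset (Fin n)), openConn a₀ v) ∩ (⋃ v ∈ ({s} : Finset (Fin n)), openConn v b))
        = 0 := by
    have hempty : ((openConn a₀ b : Set (BondConfig (Fin n)))ᶜ ∩ (⋃ v ∈ ({s} : Finset (Fin n)), openConn a₀ v)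
        ∩ (⋃ v ∈ ({s} : Finset (Fin n)), openConn v b)) = ∅ := by
      ext ω
      simp only [Finset.set_biUnion_singleton, Set.mem_inter_iff, Set.mem_compl_iff, Set.mem_empty_iff_false,
        iff_false, not_and]
      intro hab hsb
      exact hab.1 ((show (openGraph ω).Reachable a₀ s from hab.2).trans (show (openGraph ω).Reachable s b from hsb))
    rw [hempty, measureReal_empty]
  -- the reach of the singleton block is the point's reach
  have hreach : (⋃ v ∈ ({s} : Finset (Fin n)), (openConn v b : Set (BondConfig (Fin n)))) = openConn s b := by
    simp only [Finset.set_biUnion_singleton]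
  -- the block pocket sum dominates the point pocket sum
  have hinf_nonneg : ∀ W : Finset (Fin n),
      0 ≤ A.inf' ⟨b, hb⟩ (fun a => (prodBernoulli u).real (openConnIn ((W : Set (Fin n))ᶜ) a b)) :=
    fun W => Finset.le_inf' _ _ fun a _ => measureReal_nonneg
  have hsum : (∑ W ∈ (Finset.univ : Finset (Finset (Fin n))).filter (fun W => s ∈ W ∧ Disjoint W A),
          (prodBernoulli u).real {ω : BondConfig (Fin n) | openCluster ω s = (W : Set (Fin n))}
            * A.inf' ⟨b, hb⟩ (fun a => (prodBernoulli u).real (openConnIn ((W : Set (Fin n))ᶜ) a b)))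
      ≤ (∑ W ∈ (Finset.univ : Finset (Finset (Fin n))).filter (fun W => Disjoint W A),
            (prodBernoulli u).real
                {ω : BondConfig (Fin n) | ∀ z : Fin n, (z ∈ W ↔ ω ∈ ⋃ v ∈ ({s} : Finset (Fin n)), openConn v z)}
              * A.inf' ⟨b, hb⟩ (fun a => (prodBernoulli u).real (openConnIn ((W : Set (Fin n))ᶜ) a b))) := by
    have hsub : (Finset.univ : Finset (Finset (Fin n))).filter (fun W => s ∈ W ∧ Disjoint W A)
        ⊆ (Finset.univ : Finset (Finset (Fin n))).filter (fun W => Disjoint W A) := by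
      intro W hW
      rw [Finset.mem_filter] at hW ⊢
      exact ⟨hW.1, hW.2.2⟩
    calc (∑ W ∈ (Finset.univ : Finset (Finset (Fin n))).filter (fun W => s ∈ W ∧ Disjoint W A),
          (prodBernoulli u).real {ω : BondConfig (Fin n) | openCluster ω s = (W : Set (Fin n))}
            * A.inf' ⟨b, hb⟩ (fun a => (prodBernoulli u).real (openConnIn ((W : Set (Fin n))ᶜ) a b)))
        = (∑ W ∈ (Finset.univ : Finset (Finset (Fin n))).filter (fun W => s ∈ W ∧ Disjoint W A),
            (prodBernoulli u).real
                {ω : BondConfig (Fin n) | ∀ z : Fin n, (z ∈ W ↔ ω ∈ ⋃ v ∈ ({s} : Finset (Fin n)), openConn v z)}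
              * A.inf' ⟨b, hb⟩ (fun a => (prodBernoulli u).real (openConnIn ((W : Set (Fin n))ᶜ) a b))) := by
          refine Finset.sum_congr rfl fun W _ => ?_
          rw [coneLine_blockEvent_singleton s W]
      _ ≤ _ := Finset.sum_le_sum_of_subset_of_nonneg hsub fun W _ _ => mul_nonneg measureReal_nonneg (hinf_nonneg W)
  rw [hgain, hreach, add_zero]
  linarith

/-- **Block goodness from the cone stub** (induction on the size of a sub-block `T ∋ s` of `S`; base `T = {s}` = point goodness
of `s`, which the induction hypothesis supplies; step = the stub). [cite: KozmaNitzan2024, §3.2 pp. 12–14] -/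
theorem coneLine_blockGood (u : Sym2 (Fin n) → unitInterval) (A S : Finset (Fin n)) (b a₀ s : Fin n)
    (sel : Finset (Fin n) → Fin n) (hb : b ∈ A) (hsel : ∀ W, sel W ∈ A) (hSA : Disjoint S A) (hs : s ∈ S)
    (ha₀ : a₀ ∈ A)
    (hmin : ∀ a ∈ A, (prodBernoulli u).real (openConn a₀ b) ≤ (prodBernoulli u).real (openConn a b))
    (hbad : ∀ v ∈ S, (prodBernoulli u).real (openConn v b) < (prodBernoulli u).real (openConn a₀ b))
    (hcone : ∀ (n : ℕ) (u : Sym2 (Fin n) → unitInterval) (A T : Finset (Fin n)) (b a₀ x : Fin n) (hb : b ∈ A),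
      Disjoint T A → T.Nonempty → x ∉ A → x ∉ T → a₀ ∈ A → 4 ≤ A.card →
      (∀ a ∈ A, (prodBernoulli u).real (openConn a₀ b) ≤ (prodBernoulli u).real (openConn a b)) →
      (∀ v ∈ insert x T, (prodBernoulli u).real (openConn v b) < (prodBernoulli u).real (openConn a₀ b)) →
      (∀ w' : Sym2 (Fin n) → unitInterval,
        (Finset.univ.filter (fun v : Fin n => ∃ y : Fin n, 0 < (w' s(y, v) : ℝ))).card
          ≤ (Finset.univ.filter (fun v : Fin n => ∃ y : Fin n, 0 < (u s(y, v) : ℝ))).card →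
        ∀ (A' : Finset (Fin n)) (o' b' : Fin n), b' ∈ A' → o' ∉ A' →
        ∀ (t : ℝ) (sel : Finset (Fin n) → Fin n), (∀ W, sel W ∈ A') →
          (∀ a ∈ A', 1 - t ≤ (prodBernoulli w').real (openConn a b')) →
          (prodBernoulli w').real ((⋃ a ∈ A', openConn o' a) ∩ (openConn o' b')ᶜ)
            + ∑ W ∈ (Finset.univ : Finset (Finset (Fin n))).filter (fun W => o' ∈ W ∧ Disjoint W A'),
                (prodBernoulli w').real {ω : BondConfig (Fin n) | openCluster ω o' = (W : Set (Fin n))}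
                  * (prodBernoulli w').real (openConnIn ((W : Set (Fin n))ᶜ) (sel W) b')ᶜ
            ≤ t) →
      (prodBernoulli u).real (openConn a₀ b)
          + (prodBernoulli u).real ((openConn a₀ b)ᶜ ∩ (⋃ v ∈ T, openConn a₀ v) ∩ (⋃ v ∈ T, openConn v b))
        ≤ (prodBernoulli u).real (⋃ v ∈ T, openConn v b)
          + (∑ W ∈ (Finset.univ : Finset (Finset (Fin n))).filter (fun W => Disjoint W A),
              (prodBernoulli u).real
                  {ω : BondConfig (Fin n) | ∀ z : Fin n, (z ∈ W ↔ ω ∈ ⋃ v ∈ T, openConn v z)}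
                * A.inf' ⟨b, hb⟩ (fun a => (prodBernoulli u).real (openConnIn ((W : Set (Fin n))ᶜ) a b))) →
      (prodBernoulli u).real (openConn a₀ b)
          + (prodBernoulli u).real
              ((openConn a₀ b)ᶜ ∩ (⋃ v ∈ insert x T, openConn a₀ v) ∩ (⋃ v ∈ insert x T, openConn v b))
        ≤ (prodBernoulli u).real (⋃ v ∈ insert x T, openConn v b)
          + (∑ W ∈ (Finset.univ : Finset (Finset (Fin n))).filter (fun W => Disjoint W A),
              (prodBernoulli u).real
                  {ω : BondConfig (Fin n) | ∀ z : Fin n, (z ∈ W ↔ ω ∈ ⋃ v ∈ insert x T, openConn v z)}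
                * A.inf' ⟨b, hb⟩ (fun a => (prodBernoulli u).real (openConnIn ((W : Set (Fin n))ᶜ) a b))))
    (hIH : ∀ w' : Sym2 (Fin n) → unitInterval,
        (Finset.univ.filter (fun v : Fin n => ∃ y : Fin n, 0 < (w' s(y, v) : ℝ))).card
          ≤ (Finset.univ.filter (fun v : Fin n => ∃ y : Fin n, 0 < (u s(y, v) : ℝ))).card →
        ∀ (A' : Finset (Fin n)) (o' b' : Fin n), b' ∈ A' → o' ∉ A' →
        ∀ (t : ℝ) (sel : Finset (Fin n) → Fin n), (∀ W, sel W ∈ A') →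
          (∀ a ∈ A', 1 - t ≤ (prodBernoulli w').real (openConn a b')) →
          (prodBernoulli w').real ((⋃ a ∈ A', openConn o' a) ∩ (openConn o' b')ᶜ)
            + ∑ W ∈ (Finset.univ : Finset (Finset (Fin n))).filter (fun W => o' ∈ W ∧ Disjoint W A'),
                (prodBernoulli w').real {ω : BondConfig (Fin n) | openCluster ω o' = (W : Set (Fin n))}
                  * (prodBernoulli w').real (openConnIn ((W : Set (Fin n))ᶜ) (sel W) b')ᶜ
            ≤ t) :
    (prodBernoulli u).real (openConn a₀ b)
        + (prodBernoulli u).real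
              ((openConn a₀ b)ᶜ ∩ (⋃ v ∈ S, openConn a₀ v) ∩ (⋃ v ∈ S, openConn v b))
      ≤ (prodBernoulli u).real (⋃ v ∈ S, openConn v b)
        + ∑ W ∈ (Finset.univ : Finset (Finset (Fin n))).filter (fun W => Disjoint W A),
            (prodBernoulli u).real {ω : BondConfig (Fin n) | ∀ z : Fin n, (z ∈ W ↔ ω ∈ ⋃ v ∈ S, openConn v z)}
              * (prodBernoulli u).real (openConnIn ((W : Set (Fin n))ᶜ) (sel W) b) := by
  -- at most two relays besides the target: the landed drift theorem closes every block at once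
  by_cases hA3 : A.card ≤ 3
  · exact blockGood_cardLeThree u A S b a₀ sel hb ha₀ hA3 ⟨s, hs⟩ hsel hmin
  have hA4 : 4 ≤ A.card := by omega
  have hsA : s ∉ A := Finset.disjoint_left.1 hSA hs
  -- point goodness of `s` (worst selection) from the induction hypothesis applied to `u` itself
  have hex : ∀ W : Finset (Fin n), ∃ a, a ∈ A ∧
      A.inf' ⟨b, hb⟩ (fun a => (prodBernoulli u).real (openConnIn ((W : Set (Fin n))ᶜ) a b)) =
        (prodBernoulli u).real (openConnIn ((W : Set (Fin n))ᶜ) a b) :=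
    fun W => Finset.exists_mem_eq_inf' ⟨b, hb⟩ _
  choose selm hselmA hselm using hex
  have hpt := hIH u le_rfl A s b hb hsA (1 - (prodBernoulli u).real (openConn a₀ b)) selm hselmA
    (fun a ha => by linarith [hmin a ha])
  rw [goodStep24_functional_eq u A s b hb selm] at hpt
  have hZpt_eq : ∑ W ∈ (Finset.univ : Finset (Finset (Fin n))).filter (fun W => s ∈ W ∧ Disjoint W A),
      (prodBernoulli u).real {ω : BondConfig (Fin n) | openCluster ω s = (W : Set (Fin n))}
        * (prodBernoulli u).real (openConnIn ((W : Set (Fin n))ᶜ) (selm W) b)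
      = (∑ W ∈ (Finset.univ : Finset (Finset (Fin n))).filter (fun W => s ∈ W ∧ Disjoint W A),
          (prodBernoulli u).real {ω : BondConfig (Fin n) | openCluster ω s = (W : Set (Fin n))}
            * A.inf' ⟨b, hb⟩ (fun a => (prodBernoulli u).real (openConnIn ((W : Set (Fin n))ᶜ) a b))) := by
    refine Finset.sum_congr rfl fun W _ => ?_
    rw [hselm W]
  rw [hZpt_eq] at hpt
  have hpoint : (prodBernoulli u).real (openConn a₀ b) ≤ (prodBernoulli u).real (openConn s b)
      + (∑ W ∈ (Finset.univ : Finset (Finset (Fin n))).filter (fun W => s ∈ W ∧ Disjoint W A),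
          (prodBernoulli u).real {ω : BondConfig (Fin n) | openCluster ω s = (W : Set (Fin n))}
            * A.inf' ⟨b, hb⟩ (fun a => (prodBernoulli u).real (openConnIn ((W : Set (Fin n))ᶜ) a b))) := by
    linarith
  -- the chain: every sub-block `T ∋ s` of `S` is good (worst selection), by induction on `|T|`
  have hchain : ∀ (m : ℕ) (T : Finset (Fin n)), T ⊆ S → s ∈ T → T.card = m →
      (prodBernoulli u).real (openConn a₀ b)
          + (prodBernoulli u).real
              ((openConn a₀ b)ᶜ ∩ (⋃ v ∈ T, openConn a₀ v) ∩ (⋃ v ∈ T, openConn v b))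
        ≤ (prodBernoulli u).real (⋃ v ∈ T, openConn v b)
          + (∑ W ∈ (Finset.univ : Finset (Finset (Fin n))).filter (fun W => Disjoint W A),
              (prodBernoulli u).real
                  {ω : BondConfig (Fin n) | ∀ z : Fin n, (z ∈ W ↔ ω ∈ ⋃ v ∈ T, openConn v z)}
                * A.inf' ⟨b, hb⟩ (fun a => (prodBernoulli u).real (openConnIn ((W : Set (Fin n))ᶜ) a b))) := by
    intro m
    induction m using Nat.strong_induction_on with
    | _ m ih =>
      intro T hTS hsT hTm
      by_cases hT1 : T.card = 1
      · -- base: `T = {s}`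
        obtain ⟨y, hy⟩ := Finset.card_eq_one.1 hT1
        have hys : y = s := by
          have : s ∈ ({y} : Finset (Fin n)) := hy ▸ hsT
          exact (Finset.mem_singleton.1 this).symm
        subst hys
        rw [hy]
        exact coneLine_blockGood_singleton u A b a₀ y hb hpoint
      · -- step: remove a vertex `x ≠ s` and grow it back with the cone stub
        have hT2 : 2 ≤ T.card := by
          have : 0 < T.card := Finset.card_pos.2 ⟨s, hsT⟩
          omega
        obtain ⟨x, hx⟩ : ∃ x, x ∈ T.erase s :=
          Finset.card_pos.1 (by rw [Finset.card_erase_of_mem hsT]; omega)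
        have hxT : x ∈ T := Finset.mem_of_mem_erase hx
        have hxs : x ≠ s := Finset.ne_of_mem_erase hx
        have hsub : T.erase x ⊆ S := (Finset.erase_subset x T).trans hTS
        have hsT' : s ∈ T.erase x := Finset.mem_erase.2 ⟨hxs.symm, hsT⟩
        have hcard' : (T.erase x).card = T.card - 1 := Finset.card_erase_of_mem hxT
        have IH := ih (T.card - 1) (by omega) (T.erase x) hsub hsT' hcard'
        have hTA' : Disjoint (T.erase x) A := Finset.disjoint_of_subset_left hsub hSA
        have hxA : x ∉ A := Finset.disjoint_left.1 hSA (hTS hxT)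
        have hxT' : x ∉ T.erase x := Finset.notMem_erase x T
        have hne : (T.erase x).Nonempty := ⟨s, hsT'⟩
        have hins : insert x (T.erase x) = T := Finset.insert_erase hxT
        have hbad' : ∀ v ∈ insert x (T.erase x),
            (prodBernoulli u).real (openConn v b) < (prodBernoulli u).real (openConn a₀ b) :=
          fun v hv => hbad v (hTS (hins ▸ hv))
        have h := hcone n u A (T.erase x) b a₀ x hb hTA' hne hxA hxT' ha₀ hA4 hmin hbad' hIH IH
        rw [hins] at h
        exact h
  have hS := hchain S.card S (subset_refl S) hs rfl
  -- compare the worst selection with `sel`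
  have hsel_le : (∑ W ∈ (Finset.univ : Finset (Finset (Fin n))).filter (fun W => Disjoint W A),
          (prodBernoulli u).real
              {ω : BondConfig (Fin n) | ∀ z : Fin n, (z ∈ W ↔ ω ∈ ⋃ v ∈ S, openConn v z)}
            * A.inf' ⟨b, hb⟩ (fun a => (prodBernoulli u).real (openConnIn ((W : Set (Fin n))ᶜ) a b)))
      ≤ ∑ W ∈ (Finset.univ : Finset (Finset (Fin n))).filter (fun W => Disjoint W A),
          (prodBernoulli u).real {ω : BondConfig (Fin n) | ∀ z : Fin n, (z ∈ W ↔ ω ∈ ⋃ v ∈ S, openConn v z)}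
            * (prodBernoulli u).real (openConnIn ((W : Set (Fin n))ᶜ) (sel W) b) := by
    refine Finset.sum_le_sum fun W _ => mul_le_mul_of_nonneg_left ?_ measureReal_nonneg
    exact Finset.inf'_le _ (hsel W)
  linarith


/-- Registered stub `stub_coneLineBlockGood_c5` of crux stmt-CriticalPhenomena-4576 (lead c5, line `peel`, skeleton v3, part 1/2):
**block goodness from the cone growth step and the induction hypothesis** (fully spelled statement). [cite: KozmaNitzan2024, §3.2 pp. 12–14] -/
theorem stub_coneLineBlockGood_c5 : ∀ (n : ℕ) (u : Sym2 (Fin n) → unitInterval) (A S : Finset (Fin n)) (b a₀ s : Fin n) (sel : Finset (Fin n) → Fin n) (hb : b ∈ A) (hsel : ∀ W, sel W ∈ A) (hSA : Disjoint S A) (hs : s ∈ S) (ha₀ : a₀ ∈ A) (hmin : ∀ a ∈ A, (prodBernoulli u).real (openConn a₀ b) ≤ (prodBernoulli u).real (openConn a b)) (hbad : ∀ v ∈ S, (prodBernoulli u).real (openConn v b) < (prodBernoulli u).real (openConn a₀ b)) (hcone : ∀ (n : ℕ) (u : Sym2 (Fin n) → unitInterval) (A T : Finset (Fin n)) (b a₀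 x : Fin n) (hb : b ∈ A), Disjoint T A → T.Nonempty → x ∉ A → x ∉ T → a₀ ∈ A → 4 ≤ A.card → (∀ a ∈ A, (prodBernoulli u).real (openConn a₀ b) ≤ (prodBernoulli u).real (openConn a b)) → (∀ v ∈ insert x T, (prodBernoulli u).real (openConn v b) < (prodBernoulli u).real (openConn a₀ b)) → (∀ w' : Sym2 (Fin n) → unitInterval, (Finset.univ.filter (fun v : Fin n => ∃ y : Fin n, 0 < (w' s(y, v) : ℝ))).card ≤ (Finset.univ.filter (fun v : Fin n => ∃ y : Fin n, 0 < (u s(y, v) : ℝ))).card → ∀ (A' : Finset (Fin n)) (o' b' : Fin n), b' ∈ A' → o' ∉ A' → ∀ (t : ℝ) (sel : Finset (Fin n) → Fin n), (∀ W, sel W ∈ A') → (∀ a ∈ A', 1 - t ≤ (prodBernoulli w').real (openConn a b')) → (prodBernoulli w').real ((⋃ a ∈ A', openConn o' a) ∩ (openConn o' b')ᶜ) + ∑ W ∈ (Finset.univ : Finset (Finset (Fin n))).filter (fun W => o' ∈ W ∧ Disjoint W A'), (prodBernoulli w').real {ω : BondConfig (Fin n) | openCluster ω o' = (W : Set (Fin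 n))} * (prodBernoulli w').real (openConnIn ((W : Set (Fin n))ᶜ) (sel W) b')ᶜ ≤ t) → (prodBernoulli u).real (openConn a₀ b) + (prodBernoulli u).real ((openConn a₀ b)ᶜ ∩ (⋃ v ∈ T, openConn a₀ v) ∩ (⋃ v ∈ T, openConn v b)) ≤ (prodBernoulli u).real (⋃ v ∈ T, openConn v b) + (∑ W ∈ (Finset.univ : Finset (Finset (Fin n))).filter (fun W => Disjoint W A), (prodBernoulli u).real {ω : BondConfig (Fin n) | ∀ z : Fin n, (z ∈ W ↔ ω ∈ ⋃ v ∈ T, openConn v z)} * A.inf' ⟨b, hb⟩ (fun a => (prodBernoulli u).real (openConnIn ((W : Set (Fin n))ᶜ) a b))) → (prodBernoulli u).real (openConn a₀ b) + (prodBernoulli u).real ((openConn a₀ b)ᶜ ∩ (⋃ v ∈ insert x T, openConn a₀ v) ∩ (⋃ v ∈ insert x T, openConn v b)) ≤ (prodBernoulli u).real (⋃ v ∈ insert x T, openConn v b) + (∑ W ∈ (Finset.univ : Finset (Finset (Fin n))).filter (fun W => Disjoint W A), (prodBernoulli u).real {ω : BondConfig (Fin n) | ∀ z : Fin n, (z ∈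 W ↔ ω ∈ ⋃ v ∈ insert x T, openConn v z)} * A.inf' ⟨b, hb⟩ (fun a => (prodBernoulli u).real (openConnIn ((W : Set (Fin n))ᶜ) a b)))) (hIH : ∀ w' : Sym2 (Fin n) → unitInterval, (Finset.univ.filter (fun v : Fin n => ∃ y : Fin n, 0 < (w' s(y, v) : ℝ))).card ≤ (Finset.univ.filter (fun v : Fin n => ∃ y : Fin n, 0 < (u s(y, v) : ℝ))).card → ∀ (A' : Finset (Fin n)) (o' b' : Fin n), b' ∈ A' → o' ∉ A' → ∀ (t : ℝ) (sel : Finset (Fin n) → Fin n), (∀ W, sel W ∈ A') → (∀ a ∈ A', 1 - t ≤ (prodBernoulli w').real (openConn a b')) → (prodBernoulli w').real ((⋃ a ∈ A', openConn o' a) ∩ (openConn o' b')ᶜ) + ∑ W ∈ (Finset.univ : Finset (Finset (Fin n))).filter (fun W => o' ∈ W ∧ Disjoint W A'), (prodBernoulli w').real {ω : BondConfig (Fin n) | openCluster ω o' = (W : Set (Fin n))} * (prodBernoulli w').real (openConnIn ((W : Set (Fin n))ᶜ) (sel W) b')ᶜ ≤ t), (prodBernoulli u).real (openConn a₀ b)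 + (prodBernoulli u).real ((openConn a₀ b)ᶜ ∩ (⋃ v ∈ S, openConn a₀ v) ∩ (⋃ v ∈ S, openConn v b)) ≤ (prodBernoulli u).real (⋃ v ∈ S, openConn v b) + ∑ W ∈ (Finset.univ : Finset (Finset (Fin n))).filter (fun W => Disjoint W A), (prodBernoulli u).real {ω : BondConfig (Fin n) | ∀ z : Fin n, (z ∈ W ↔ ω ∈ ⋃ v ∈ S, openConn v z)} * (prodBernoulli u).real (openConnIn ((W : Set (Fin n))ᶜ) (sel W) b) :=
  fun _ u A S b a₀ s sel hb hsel hSA hs ha₀ hmin hbad hcone hIH =>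
    coneLine_blockGood u A S b a₀ s sel hb hsel hSA hs ha₀ hmin hbad hcone hIH

end

end Summit.CriticalPhenomena.PercolationContinuityZ3.Theorems
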